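import Summits.QuantumFields.YangMills.Theorems.AllWindowsColdBoxBoxHighLineStep2Tilt
import Summits.QuantumFields.YangMills.Theorems.AllWindowsColdBoxBoxHighLineActionSandwichPlaquetteCost
import Summits.QuantumFields.YangMills.Theorems.AllWindowsColdBoxBoxHighLineBootstrapCirculationBound

/-!
# T-S5.6s `smallFieldSmallPlaquettes : SmallFieldSmallPlaquettes` BY NAME — small chart fields have small plaquettes
# (ASSEMBLY-S5 / task file ✓`…Theorems.AllWindowsColdBoxBoxHighLineStep2Tilt`; LINE-19 S5 ⟨stmt-QuantumFields-24004⟩/⟨24335⟩)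

Width seat `ym-line-sfw-p2-w3` (g40, cell `ym-idea-1`), routed by planner ym-idea-2 g18 (2026-08-29T19:46:09Z «w3: (ii) T-S5.6s»).

**Theorem (`smallFieldSmallPlaquettes`).**  For `0 ≤ s ≤ 1/100` and `17 s² ≤ spl²`: every `a ∈ smallField H s` has `SmallPlaquettes H spl (edgeChart H a)`,
i.e. every plaquette of the edge-chart configuration has cost `2 − Re tr U_p ≤ spl²`.

Proof.  Every link of `edgeChart H a` is `expPauli v` with `‖v‖ ≤ s` (`v = a_e` on the box edges, `v = 0` off the box: `norm_freeVec_le`), so each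
plaquette holonomy is `e^{iv₁} e^{iv₂} e^{−iv₃} e^{−iv₄}` with `‖v_k‖ ≤ s`; w2 g30's second-order trace estimate ✓`PlaqCost.abs_plaquetteCost_sub_dot_le`
(with `p_k = sinc‖v_k‖·v_k`, `S = p₁+p₂−p₃−p₄`: `|cost − S·S| ≤ 2t·√(S·S)·Σ‖v_k‖ + 11t²·Σ‖v_k‖²`) and `‖S‖ ≤ 4s` give
`cost ≤ 16s² + 32s³ + 44s⁴ ≤ 17s² ≤ spl²` for `s ≤ 1/100` (`cost_le`).  (The base-point and `i ≠ j` hypotheses of `SmallPlaquettes` are not needed.)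

Everything proved, Mathlib + tree only (✓`plaqCostAt_eq_two_sub`), standard axioms; no definitions.
HONEST LABEL: an S-sized brick of the ASSEMBLY of the XL stub S5 (`stub_landauSecondOrder`) of a critic-PASSed DRAFT line; S5, U5, ⟨24004⟩ ⟨24335⟩
⟨24336⟩ remain OPEN; no stub is closed by name, no crux, rung or summit is proved; **the Yang–Mills mass gap is NOT proved by this file.**
-/

set_option autoImplicit false

noncomputable section

open Matrix Finset Real
open Literature.Probability.LatticeModels (Site)
open Literature.MathematicalPhysics.QuantumFieldTheory.Balaban1983to89.B10Eq18SigmaSU2Haar (expPauli)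
open Literature.MathematicalPhysics.QuantumLattice (ZdEdge LGConfig fundamentalRep plaquetteHolonomyZd)
open Summit.QuantumFields.YangMills.Theorems.WeakCouplingRates (plaqCostAt)

namespace Summit.QuantumFields.YangMills.Theorems.AllWindowsColdBoxBoxHighLine

namespace SmallFieldPlaq

/-- On a small field every chart variable (including the zero off-box ones) has norm `≤ s`. -/
theorem norm_freeVec_le {H : ℕ} {s : ℝ} {a : LandauFree H → E3} (ha : a ∈ smallField H s) (hs : 0 ≤ s) (e : ZdEdge 4) :
    ‖freeVec H a e‖ ≤ s := by
  unfold freeVec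
  split_ifs
  · exact ha _
  · simpa using hs
  · simpa using hs

/-- `ofLp V · ofLp V = ‖V‖²` in `ℝ³`. -/
theorem dotProduct_self_eq_norm_sq (V : E3) : WithLp.ofLp V ⬝ᵥ WithLp.ofLp V = ‖V‖ ^ 2 := by
  rw [EuclideanSpace.norm_sq_eq]
  simp only [dotProduct, Real.norm_eq_abs, sq, abs_mul_abs_self]

/-- A `sinc`-rescaled vector is no longer than the vector. -/
theorem norm_sinc_smul_le (v : E3) : ‖Real.sinc ‖v‖ • v‖ ≤ ‖v‖ := by
  rw [norm_smul, Real.norm_eq_abs]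
  calc |Real.sinc ‖v‖| * ‖v‖ ≤ 1 * ‖v‖ := mul_le_mul_of_nonneg_right (Real.abs_sinc_le_one _) (norm_nonneg _)
    _ = ‖v‖ := one_mul _

/-- **Four chart links of size `≤ t ≤ 1` have plaquette cost `≤ 16t² + 32t³ + 44t⁴`** (from ✓`PlaqCost.abs_plaquetteCost_sub_dot_le`). -/
theorem cost_le (v₁ v₂ v₃ v₄ : E3) {t : ℝ} (ht0 : 0 ≤ t) (ht : t ≤ 1)
    (h₁ : ‖v₁‖ ≤ t) (h₂ : ‖v₂‖ ≤ t) (h₃ : ‖v₃‖ ≤ t) (h₄ : ‖v₄‖ ≤ t) :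
    2 - (((expPauli v₁ * expPauli v₂ * (expPauli v₃)⁻¹ * (expPauli v₄)⁻¹ : SU2) : Matrix (Fin 2) (Fin 2) ℂ)).trace.re ≤
      16 * t ^ 2 + 32 * t ^ 3 + 44 * t ^ 4 := by
  have key := PlaqCost.abs_plaquetteCost_sub_dot_le v₁ v₂ v₃ v₄ ht h₁ h₂ h₃ h₄
  set S : Fin 3 → ℝ := Real.sinc ‖v₁‖ • WithLp.ofLp v₁ + Real.sinc ‖v₂‖ • WithLp.ofLp v₂ - Real.sinc ‖v₃‖ • WithLp.ofLp v₃ -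
    Real.sinc ‖v₄‖ • WithLp.ofLp v₄ with hS
  set V : E3 := Real.sinc ‖v₁‖ • v₁ + Real.sinc ‖v₂‖ • v₂ - Real.sinc ‖v₃‖ • v₃ - Real.sinc ‖v₄‖ • v₄ with hV
  have hSV : S = WithLp.ofLp V := by
    simp only [hS, hV, WithLp.ofLp_add, WithLp.ofLp_sub, WithLp.ofLp_smul]
  have hVn : ‖V‖ ≤ 4 * t := by
    have e1 := (norm_sinc_smul_le v₁).trans h₁
    have e2 := (norm_sinc_smul_le v₂).trans h₂
    have e3 := (norm_sinc_smul_le v₃).trans h₃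
    have e4 := (norm_sinc_smul_le v₄).trans h₄
    calc ‖V‖ ≤ ‖Real.sinc ‖v₁‖ • v₁ + Real.sinc ‖v₂‖ • v₂ - Real.sinc ‖v₃‖ • v₃‖ + ‖Real.sinc ‖v₄‖ • v₄‖ := norm_sub_le _ _
      _ ≤ (‖Real.sinc ‖v₁‖ • v₁ + Real.sinc ‖v₂‖ • v₂‖ + ‖Real.sinc ‖v₃‖ • v₃‖) + ‖Real.sinc ‖v₄‖ • v₄‖ := by
          gcongr; exact norm_sub_le _ _
      _ ≤ ((‖Real.sinc ‖v₁‖ • v₁‖ + ‖Real.sinc ‖v₂‖ • v₂‖) + ‖Real.sinc ‖v₃‖ • v₃‖) + ‖Real.sinc ‖v₄‖ • v₄‖ := by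
          gcongr; exact norm_add_le _ _
      _ ≤ ((t + t) + t) + t := by gcongr
      _ = 4 * t := by ring
  have hSS : S ⬝ᵥ S = ‖V‖ ^ 2 := by rw [hSV, dotProduct_self_eq_norm_sq]
  have hSS16 : S ⬝ᵥ S ≤ 16 * t ^ 2 := by
    rw [hSS]; nlinarith [norm_nonneg V]
  have hsqrt : Real.sqrt (S ⬝ᵥ S) ≤ 4 * t := by
    rw [hSS, Real.sqrt_sq (norm_nonneg _)]; exact hVn
  have hsum1 : ‖v₁‖ + ‖v₂‖ + ‖v₃‖ + ‖v₄‖ ≤ 4 * t := by linarith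
  have hsum2 : ‖v₁‖ ^ 2 + ‖v₂‖ ^ 2 + ‖v₃‖ ^ 2 + ‖v₄‖ ^ 2 ≤ 4 * t ^ 2 := by
    nlinarith [norm_nonneg v₁, norm_nonneg v₂, norm_nonneg v₃, norm_nonneg v₄]
  have hmid : 2 * t * Real.sqrt (S ⬝ᵥ S) * (‖v₁‖ + ‖v₂‖ + ‖v₃‖ + ‖v₄‖) ≤ 2 * t * (4 * t) * (4 * t) := by
    have h2t : 0 ≤ 2 * t := by linarith
    have hs0 : 0 ≤ Real.sqrt (S ⬝ᵥ S) := Real.sqrt_nonneg _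
    have hn0 : 0 ≤ ‖v₁‖ + ‖v₂‖ + ‖v₃‖ + ‖v₄‖ := by positivity
    exact mul_le_mul (mul_le_mul_of_nonneg_left hsqrt h2t) hsum1 hn0 (by positivity)
  have hlast : 11 * t ^ 2 * (‖v₁‖ ^ 2 + ‖v₂‖ ^ 2 + ‖v₃‖ ^ 2 + ‖v₄‖ ^ 2) ≤ 11 * t ^ 2 * (4 * t ^ 2) :=
    mul_le_mul_of_nonneg_left hsum2 (by positivity)
  have hk := (abs_le.1 key).2
  nlinarith [hk, hSS16, hmid, hlast]

end SmallFieldPlaq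

open SmallFieldPlaq in
/-- **T-S5.6s `SmallFieldSmallPlaquettes`, BY NAME**: `0 ≤ s ≤ 1/100`, `17 s² ≤ spl²`, `a ∈ smallField H s` ⇒ `SmallPlaquettes H spl (edgeChart H a)`. -/
theorem smallFieldSmallPlaquettes : SmallFieldSmallPlaquettes := by
  intro H s spl hs0 hs1 hspl a ha
  unfold SmallPlaquettes
  intro x _ i j _
  rw [plaqCostAt_eq_two_sub]
  have hhol : plaquetteHolonomyZd (edgeChart H a) x i j =
      expPauli (freeVec H a (x, i)) * expPauli (freeVec H a (x + Pi.single i 1, j)) *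
        (expPauli (freeVec H a (x + Pi.single j 1, i)))⁻¹ * (expPauli (freeVec H a (x, j)))⁻¹ := rfl
  rw [hhol]
  have hs1' : s ≤ 1 := by linarith
  have h := cost_le (freeVec H a (x, i)) (freeVec H a (x + Pi.single i 1, j)) (freeVec H a (x + Pi.single j 1, i))
    (freeVec H a (x, j)) hs0 hs1' (norm_freeVec_le ha hs0 _) (norm_freeVec_le ha hs0 _) (norm_freeVec_le ha hs0 _)
    (norm_freeVec_le ha hs0 _)
  have h32 : 32 * s ^ 3 ≤ 32 / 100 * s ^ 2 := by nlinarith [sq_nonneg s]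
  have h44 : 44 * s ^ 4 ≤ 44 / 10000 * s ^ 2 := by nlinarith [sq_nonneg s, mul_nonneg hs0 hs0]
  refine h.trans ?_
  have hsq : 0 ≤ s ^ 2 := sq_nonneg s
  linarith

end Summit.QuantumFields.YangMills.Theorems.AllWindowsColdBoxBoxHighLine

end
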